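import Summits.BirchSwinnertonDyer.BirchSwinnertonDyer.Theorems.ManinLocalTwoThreeKummerWitnessInvarianceTransforms
import Summits.BirchSwinnertonDyer.BirchSwinnertonDyer.Theorems.ManinLocalTwoThreeKummerCubeRootHolomorphicExtension
import Literature.NumberTheory.EllipticCurves.ModularFunctionField
import HarnessLib

/-!
# (INV-b) The good set `{w ∉ Λ, y_W∘φ ≠ 0}` is co-discrete; the integer pole killer vanishes on no punctured disc
(route `ManinLocalTwoThree`, crux C3 `ManinPrimeToThreeAtNine` stmt-BirchSwinnertonDyer-22968; cell bsd-f2-manin, p2 gen 17;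
`--supports stmt-BirchSwinnertonDyer-22968`; second file toward (INV) `UDCKummerWitnessLine.KummerMinimalWitnessInvariance`)

* `exists_minimal_package` — entire `Q` (`Q(0) = −2`) and `A` (`A(0) = σ(−u)`) with, off `φ⁻¹(O)`, `minimalY = (c³/2)·Q(w)/σ(w)³` and, where
  moreover `Q(w) ≠ 0`, `kummerMinBlock = −2·A(w)·e^{ew/3}/Q(w)` (`w = c·E_f`; `Q = P₃ − a₁P₂σ + (a₁b₂/12 − a₃)σ³`, `A = (P₂ − (b₂/12)σ²)·σ(· − u)`);
* `eventually_ne_zero_of_entire` (isolated zeros of a non-zero entire function), `tendsto_smul_eichlerIntegral_nhdsWithin_ne` (`w` is nowhere locally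
  constant: tree `not_eventually_const_eichlerIntegral`), hence **`eventually_comp_ne_zero`**: `Z(w(τ)) ≠ 0` on a punctured neighbourhood of every
  point, for every entire `Z ≢ 0` — in particular the good set is co-discrete (`eventually_good`);
* **`not_eventually_kummerPoleKiller_eq_zero`** — for `P ≠ 0` the killer `(Δ^{deg P}P(j))ⁿ` does not vanish on a punctured neighbourhood of any
  point of `ℍ` (else `j` is locally constant, `E₄³ − rΔ = 0` as a form, and the constant terms give `1 = r·0`; tree `constantCoeff_qExpansion_E₄cube`,
  `constantCoeff_qExpansion_delta`).
HONEST FRAMING.  Bookkeeping for (INV); BSD is not proved by this; Manin's conjecture is not proved; C2 and C3 remain OPEN.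
[folklore]
-/

set_option autoImplicit false
-- lint-debt: the directory name repeats the summit name (sibling precedent `ManinLocalTwoThreeKummerCubeRootSigmaAutomorphy.lean`)
set_option linter.dupNamespace false

noncomputable section

open scoped Topology PeriodPair MatrixGroups Manifold ModularForm
open Complex Filter CongruenceSubgroup
open UpperHalfPlane hiding I
open Literature.NumberTheory.EllipticCurves Literature.NumberTheory.EllipticCurves.ModularForms
open Summit.BirchSwinnertonDyer.Rank1Residual.ManinAdditive.KummerCubeMonodromy
open Summit.BirchSwinnertonDyer.Rank1Residual.ManinAdditive.UDCKummerWitnessLine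
open Summit.BirchSwinnertonDyer.BirchSwinnertonDyer.Theorems.ManinLocalTwoThree.KummerCubeRootDictionary

namespace Summit.BirchSwinnertonDyer.BirchSwinnertonDyer.Theorems.ManinLocalTwoThree.WitnessInvariance

variable {W : WeierstrassCurve ℚ} {N : ℕ} [NeZero N]

/-! ### §1 The entire package behind `minimalY` and the block -/

/-- **Entire numerators for `y_W∘φ` and the minimal block**: see the file header. [folklore] -/
theorem exists_minimal_package (D : ModularParametrizationData W N) (hc0 : D.c ≠ 0) (u e : ℂ) :
    ∃ Q A : ℂ → ℂ, Differentiable ℂ Q ∧ Differentiable ℂ A ∧ Q 0 = -2 ∧ A 0 = D.L.weierstrassSigma (-u) ∧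
      (∀ τ : ℍ, (D.c : ℂ) * eichlerIntegral D.f τ ∉ D.L.lattice →
        minimalY D τ = (D.c : ℂ) ^ 3 / 2 * Q ((D.c : ℂ) * eichlerIntegral D.f τ) /
          D.L.weierstrassSigma ((D.c : ℂ) * eichlerIntegral D.f τ) ^ 3) ∧
      (∀ τ : ℍ, (D.c : ℂ) * eichlerIntegral D.f τ ∉ D.L.lattice → Q ((D.c : ℂ) * eichlerIntegral D.f τ) ≠ 0 →
        kummerMinBlock D u e τ = -2 * A ((D.c : ℂ) * eichlerIntegral D.f τ) *
          cexp (e * ((D.c : ℂ) * eichlerIntegral D.f τ) / 3) / Q ((D.c : ℂ) * eichlerIntegral D.f τ)) := by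
  obtain ⟨P₂, P₃, hP₂, hP₃, hP₂0, hP₃0, hP₂eq, hP₃eq⟩ := exists_entire_weierstrassP_sigma_values D.L
  have hσ : Differentiable ℂ D.L.weierstrassSigma := D.L.differentiable_weierstrassSigma_holds
  have hc : (D.c : ℂ) ≠ 0 := Int.cast_ne_zero.mpr hc0
  have hσne : ∀ w, w ∉ D.L.lattice → D.L.weierstrassSigma w ≠ 0 := fun w hw h =>
    hw ((D.L.weierstrassSigma_eq_zero_iff_holds w).mp h)
  refine ⟨fun w => P₃ w - (W.a₁ : ℂ) * P₂ w * D.L.weierstrassSigma w +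
      ((W.a₁ : ℂ) * (W.b₂ : ℂ) / 12 - (W.a₃ : ℂ)) * D.L.weierstrassSigma w ^ 3,
    fun w => (P₂ w - (W.b₂ : ℂ) / 12 * D.L.weierstrassSigma w ^ 2) * D.L.weierstrassSigma (w - u),
    ?_, ?_, ?_, ?_, ?_, ?_⟩
  · exact ((hP₃.sub ((differentiable_const _).mul hP₂ |>.mul hσ)).add ((differentiable_const _).mul (hσ.pow 3)))
  · exact (hP₂.sub ((differentiable_const _).mul (hσ.pow 2))).mul (hσ.comp (differentiable_id.sub_const u))
  · simp [hP₃0]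
  · simp [hP₂0]
  · intro τ hw
    set w : ℂ := (D.c : ℂ) * eichlerIntegral D.f τ with hw_def
    have hσw := hσne w hw
    have h℘ : ℘[D.L] w = P₂ w / D.L.weierstrassSigma w ^ 2 := by
      rw [hP₂eq w hw]; field_simp
    have h℘' : ℘'[D.L] w = P₃ w / D.L.weierstrassSigma w ^ 3 := by
      rw [hP₃eq w hw]; field_simp
    rw [minimalY, shortX, shortY, ← hw_def, h℘, h℘']
    field_simp
    ring
  · intro τ hw hQ
    set w : ℂ := (D.c : ℂ) * eichlerIntegral D.f τ with hw_def
    have hσw := hσne w hw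
    have h℘ : ℘[D.L] w = P₂ w / D.L.weierstrassSigma w ^ 2 := by
      rw [hP₂eq w hw]; field_simp
    have h℘' : ℘'[D.L] w = P₃ w / D.L.weierstrassSigma w ^ 3 := by
      rw [hP₃eq w hw]; field_simp
    have hY : minimalY D τ = (D.c : ℂ) ^ 3 / 2 * (P₃ w - (W.a₁ : ℂ) * P₂ w * D.L.weierstrassSigma w +
        ((W.a₁ : ℂ) * (W.b₂ : ℂ) / 12 - (W.a₃ : ℂ)) * D.L.weierstrassSigma w ^ 3) / D.L.weierstrassSigma w ^ 3 := by
      rw [minimalY, shortX, shortY, ← hw_def, h℘, h℘']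
      field_simp
      ring
    rw [kummerMinBlock, minimalParam, sigmaCubeRoot, hY, shortX, ← hw_def, h℘]
    field_simp

/-! ### §2 Isolated zeros, composed with the nowhere locally constant `w = c·E_f` -/

/-- A non-zero entire function is non-zero on a punctured neighbourhood of every point. [folklore] -/
theorem eventually_ne_zero_of_entire {Z : ℂ → ℂ} (hZ : Differentiable ℂ Z) (hne : ∃ w, Z w ≠ 0) (w₀ : ℂ) :
    ∀ᶠ w in 𝓝[≠] w₀, Z w ≠ 0 := by
  rcases (hZ.analyticAt w₀).eventually_eq_or_eventually_ne (analyticAt_const (v := (0 : ℂ))) with h | h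
  · exfalso
    obtain ⟨w₁, hw₁⟩ := hne
    have han : AnalyticOnNhd ℂ Z Set.univ := fun w _ => hZ.analyticAt w
    have := han.eqOn_zero_of_preconnected_of_eventuallyEq_zero isPreconnected_univ (Set.mem_univ w₀) h
    exact hw₁ (this (Set.mem_univ w₁))
  · exact h

/-- `w = c·E_f` (in the complex coordinate) tends to `w(τ₀)` WITHIN `≠` along `𝓝[≠] τ₀`: it is continuous and nowhere locally constant.
[folklore] -/
theorem tendsto_smul_eichlerIntegral_nhdsWithin_ne (D : ModularParametrizationData W N) (hc0 : D.c ≠ 0) (hf : D.f ≠ 0) (τ₀ : ℍ) :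
    Tendsto (fun z : ℂ => (D.c : ℂ) * eichlerIntegral D.f (ofComplex z)) (𝓝[≠] (τ₀ : ℂ))
      (𝓝[≠] ((D.c : ℂ) * eichlerIntegral D.f τ₀)) := by
  have hc : (D.c : ℂ) ≠ 0 := Int.cast_ne_zero.mpr hc0
  have han : AnalyticAt ℂ (fun z : ℂ => (D.c : ℂ) * eichlerIntegral D.f (ofComplex z)) (τ₀ : ℂ) :=
    analyticAt_const.mul (analyticAt_eichlerIntegral_comp_ofComplex D.f τ₀.im_pos)
  have hval : (fun z : ℂ => (D.c : ℂ) * eichlerIntegral D.f (ofComplex z)) (τ₀ : ℂ) = (D.c : ℂ) * eichlerIntegral D.f τ₀ := by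
    simp only [ofComplex_apply]
  refine tendsto_nhdsWithin_iff.mpr ⟨?_, ?_⟩
  · have h : Tendsto (fun z : ℂ => (D.c : ℂ) * eichlerIntegral D.f (ofComplex z)) (𝓝 (τ₀ : ℂ))
        (𝓝 ((D.c : ℂ) * eichlerIntegral D.f τ₀)) := by
      simpa only [ofComplex_apply] using han.continuousAt.tendsto
    exact h.mono_left nhdsWithin_le_nhds
  · rcases han.eventually_eq_or_eventually_ne (analyticAt_const (v := (D.c : ℂ) * eichlerIntegral D.f τ₀)) with h | h
    · exfalso
      apply not_eventually_const_eichlerIntegral D.f hf τ₀.im_pos (eichlerIntegral D.f τ₀)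
      filter_upwards [h] with z hz
      exact mul_left_cancel₀ hc hz
    · filter_upwards [h] with z hz
      exact hz

/-- **Composition**: for an entire `Z ≢ 0`, `Z(w(τ)) ≠ 0` on a punctured neighbourhood of every point of `ℍ` (complex coordinate). [folklore] -/
theorem eventually_comp_ne_zero (D : ModularParametrizationData W N) (hc0 : D.c ≠ 0) (hf : D.f ≠ 0) (τ₀ : ℍ)
    {Z : ℂ → ℂ} (hZ : Differentiable ℂ Z) (hne : ∃ w, Z w ≠ 0) :
    ∀ᶠ z in 𝓝[≠] (τ₀ : ℂ), Z ((D.c : ℂ) * eichlerIntegral D.f (ofComplex z)) ≠ 0 :=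
  (tendsto_smul_eichlerIntegral_nhdsWithin_ne D hc0 hf τ₀).eventually (eventually_ne_zero_of_entire hZ hne _)

/-- A function continuous at `0` with non-zero value, times `σ`, is non-zero somewhere (indeed near `0`, off `0`). [folklore] -/
theorem exists_sigma_mul_ne_zero (L : PeriodPair) {Q : ℂ → ℂ} (hQ : ContinuousAt Q 0) (hQ0 : Q 0 ≠ 0) :
    ∃ w, L.weierstrassSigma w * Q w ≠ 0 := by
  have h1 : ∀ᶠ w in 𝓝[≠] (0 : ℂ), Q w ≠ 0 := (hQ.eventually_ne hQ0).filter_mono nhdsWithin_le_nhds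
  have h2 : ∀ᶠ w in 𝓝[≠] (0 : ℂ), L.weierstrassSigma w ≠ 0 := by
    have hA : ∀ᶠ w in 𝓝[≠] (0 : ℂ), w ∈ ((L.lattice : Set ℂ) \ {0})ᶜ :=
      mem_nhdsWithin_of_mem_nhds (L.compl_lattice_sdiff_singleton_mem_nhds 0)
    have hB : ∀ᶠ w in 𝓝[≠] (0 : ℂ), w ≠ 0 := self_mem_nhdsWithin
    filter_upwards [hA, hB] with w hw hw0 hσ
    apply hw
    exact ⟨(L.weierstrassSigma_eq_zero_iff_holds w).mp hσ, hw0⟩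
  obtain ⟨w, hw⟩ := (h2.and h1).exists
  exact ⟨w, mul_ne_zero hw.1 hw.2⟩

/-- **The good set is co-discrete**: off `φ⁻¹(O)` and off `y_W∘φ = 0` on a punctured neighbourhood of every point. [folklore] -/
theorem eventually_good (D : ModularParametrizationData W N) (hc0 : D.c ≠ 0) (hf : D.f ≠ 0) (τ₀ : ℍ) :
    ∀ᶠ z in 𝓝[≠] (τ₀ : ℂ), (D.c : ℂ) * eichlerIntegral D.f (ofComplex z) ∉ D.L.lattice ∧ minimalY D (ofComplex z) ≠ 0 := by
  obtain ⟨Q, A, hQd, -, hQ0, -, hY, -⟩ := exists_minimal_package D hc0 0 0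
  have hc : (D.c : ℂ) ≠ 0 := Int.cast_ne_zero.mpr hc0
  have hσ : Differentiable ℂ D.L.weierstrassSigma := D.L.differentiable_weierstrassSigma_holds
  have hZ : Differentiable ℂ (fun w => D.L.weierstrassSigma w * Q w) := hσ.mul hQd
  have hne := exists_sigma_mul_ne_zero D.L hQd.continuous.continuousAt (by rw [hQ0]; norm_num)
  filter_upwards [eventually_comp_ne_zero D hc0 hf τ₀ hZ hne] with z hz
  have hσz : D.L.weierstrassSigma ((D.c : ℂ) * eichlerIntegral D.f (ofComplex z)) ≠ 0 := left_ne_zero_of_mul hz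
  have hQz : Q ((D.c : ℂ) * eichlerIntegral D.f (ofComplex z)) ≠ 0 := right_ne_zero_of_mul hz
  have hw : (D.c : ℂ) * eichlerIntegral D.f (ofComplex z) ∉ D.L.lattice := fun h =>
    hσz ((D.L.weierstrassSigma_eq_zero_iff_holds _).mpr h)
  refine ⟨hw, ?_⟩
  rw [hY _ hw]
  exact div_ne_zero (mul_ne_zero (div_ne_zero (pow_ne_zero 3 hc) two_ne_zero) hQz) (pow_ne_zero 3 hσz)

/-! ### §3 The killer vanishes on no punctured disc -/

/-- `(Δ^{deg P}P(j))ⁿ` written through `P(j)`: `kummerPoleKiller P n τ = (Δ(τ)^{deg P}·P(E₄³/Δ)(τ))ⁿ`. [folklore] -/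
theorem kummerPoleKiller_eq_pow (P : Polynomial ℤ) (n : ℕ) (τ : ℍ) :
    kummerPoleKiller P n τ = (ModularForm.discriminant τ ^ P.natDegree *
      P.eval₂ (Int.castRingHom ℂ) (ModularForm.E₄ τ ^ 3 / ModularForm.discriminant τ)) ^ n := by
  unfold kummerPoleKiller
  congr 1
  have hΔ := ModularForm.discriminant_ne_zero τ
  rw [Polynomial.eval₂_eq_sum_range, Finset.mul_sum]
  refine Finset.sum_congr rfl fun i hi => ?_
  obtain ⟨j, hj⟩ := Nat.exists_eq_add_of_le (Nat.lt_succ_iff.mp (Finset.mem_range.mp hi))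
  rw [hj, Nat.add_sub_cancel_left, eq_intCast, div_pow, ← pow_mul, pow_add]
  field_simp

/-- **For `P ≠ 0`, the killer does not vanish on a punctured neighbourhood of a point of `ℍ`.** [folklore] -/
theorem not_eventually_kummerPoleKiller_eq_zero {P : Polynomial ℤ} (hP : P ≠ 0) (n : ℕ) {z₀ : ℂ} (hz₀ : 0 < z₀.im) :
    ¬ ∀ᶠ z in 𝓝[≠] z₀, kummerPoleKiller P n (ofComplex z) = 0 := by
  intro h
  rcases Nat.eq_zero_or_pos n with rfl | hn
  · obtain ⟨z, hz⟩ := h.exists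
    simp [kummerPoleKiller] at hz
  -- `P(j) = 0` on the punctured neighbourhood
  set jf : ℂ → ℂ := fun z => ModularForm.E₄ (ofComplex z) ^ 3 / ModularForm.discriminant (ofComplex z) with hjf
  set R : Set ℂ := {x : ℂ | P.eval₂ (Int.castRingHom ℂ) x = 0} with hR
  have hRfin : R.Finite := by
    have hmap : P.map (Int.castRingHom ℂ) ≠ 0 := fun h0 =>
      hP ((Polynomial.map_eq_zero_iff (Int.castRingHom ℂ).injective_int).mp h0)
    refine (Polynomial.finite_setOf_isRoot hmap).subset fun x hx => ?_
    rw [Set.mem_setOf_eq, Polynomial.IsRoot.def, Polynomial.eval_map]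
    exact hx
  have hroot : ∀ᶠ z in 𝓝[≠] z₀, jf z ∈ R := by
    filter_upwards [h] with z hz
    rw [kummerPoleKiller_eq_pow] at hz
    have h1 := (pow_eq_zero_iff hn.ne').mp hz
    exact (mul_eq_zero.mp h1).resolve_left (pow_ne_zero _ (ModularForm.discriminant_ne_zero _))
  -- `jf` is continuous at `z₀`
  have hE : DifferentiableAt ℂ (fun z : ℂ => ModularForm.E₄ (ofComplex z)) z₀ :=
    UpperHalfPlane.mdifferentiableAt_iff.mp (ModularFormClass.holo ModularForm.E₄ ⟨z₀, hz₀⟩)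
  have hD : DifferentiableAt ℂ (fun z : ℂ => ModularForm.discriminant (ofComplex z)) z₀ :=
    UpperHalfPlane.mdifferentiableAt_iff.mp (ModularFormClass.holo CuspForm.discriminant ⟨z₀, hz₀⟩)
  have hjc : ContinuousAt jf z₀ := ((hE.pow 3).div hD (ModularForm.discriminant_ne_zero _)).continuousAt
  have hjt : Tendsto jf (𝓝[≠] z₀) (𝓝 (jf z₀)) := hjc.tendsto.mono_left nhdsWithin_le_nhds
  have hz₀R : jf z₀ ∈ R := hRfin.isClosed.mem_of_tendsto hjt hroot
  have hR' : ∀ᶠ y in 𝓝 (jf z₀), y ∉ R \ {jf z₀} :=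
    (hRfin.subset fun x hx => hx.1).isClosed.isOpen_compl.mem_nhds (by simp)
  have hjeq : ∀ᶠ z in 𝓝[≠] z₀, jf z = jf z₀ := by
    filter_upwards [hroot, hjt.eventually hR'] with z h1 h2
    by_contra hne
    exact h2 ⟨h1, hne⟩
  -- `E₄³ = r·Δ` near `z₀`
  set r : ℂ := jf z₀ with hr
  have hfull : ∀ᶠ z in 𝓝 z₀, 0 < z.im → ModularForm.E₄ (ofComplex z) ^ 3 = r * ModularForm.discriminant (ofComplex z) := by
    filter_upwards [eventually_nhdsWithin_iff.mp hjeq] with z hz _hzim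
    have hjz : jf z = r := by
      by_cases hzz : z = z₀
      · rw [hzz]
      · exact hz hzz
    have hΔ := ModularForm.discriminant_ne_zero (ofComplex z)
    rw [← hjz, hjf]
    field_simp
  -- the holomorphic function `E₄³ − r·Δ` vanishes near `z₀`, hence on `ℍ` (identity theorem)
  set g : ℍ → ℂ := fun τ => ModularForm.E₄ τ ^ 3 - r * ModularForm.discriminant τ with hg
  have hEon : DifferentiableOn ℂ (⇑ModularForm.E₄ ∘ ofComplex) {w : ℂ | 0 < w.im} :=
    UpperHalfPlane.mdifferentiable_iff.mp (ModularFormClass.holo ModularForm.E₄)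
  have hΔon : DifferentiableOn ℂ (⇑CuspForm.discriminant ∘ ofComplex) {w : ℂ | 0 < w.im} :=
    UpperHalfPlane.mdifferentiable_iff.mp (ModularFormClass.holo CuspForm.discriminant)
  have hgon : DifferentiableOn ℂ (g ∘ ofComplex) {w : ℂ | 0 < w.im} := by
    have h := (hEon.pow 3).sub (hΔon.const_mul r)
    refine h.congr fun z _ => ?_
    simp only [Function.comp_apply, hg]
    rfl
  have han : AnalyticOnNhd ℂ (g ∘ ofComplex) {w : ℂ | 0 < w.im} := hgon.analyticOnNhd isOpen_upperHalfPlaneSet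
  have hg0 : ∀ᶠ w in 𝓝 z₀, (g ∘ ofComplex) w = 0 := by
    filter_upwards [hfull, isOpen_upperHalfPlaneSet.mem_nhds hz₀] with z hz hzim
    simp only [Function.comp_apply, hg]
    rw [hz hzim, sub_self]
  have heq := han.eqOn_zero_of_preconnected_of_eventuallyEq_zero (convex_halfSpace_im_gt 0).isPreconnected hz₀ hg0
  have hforms : ofLevelOne (Gamma0 1) E₄cube = r • ofLevelOne (Gamma0 1) delta := by
    apply DFunLike.ext
    intro τ
    have h1 := heq τ.im_pos
    simp only [Function.comp_apply, ofComplex_apply, hg, Pi.zero_apply, sub_eq_zero] at h1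
    rw [ModularForm.IsGLPos.smul_apply, coe_ofLevelOne, coe_ofLevelOne, E₄cube_apply, delta_apply, smul_eq_mul]
    exact h1
  haveI : NeZero (1 : ℕ) := ⟨one_ne_zero⟩
  have hq := congrArg (qExpansionL 1) hforms
  rw [qExpansionL_smul, qExpansionL_def, qExpansionL_def] at hq
  have hcoef := congrArg (fun x : LaurentSeries ℂ => x.coeff ((0 : ℕ) : ℤ)) hq
  simp only [HahnSeries.coeff_smul, smul_eq_mul, HahnSeries.ofPowerSeries_apply_coeff,
    PowerSeries.coeff_zero_eq_constantCoeff_apply] at hcoef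
  have h1 : PowerSeries.constantCoeff (qExpansion 1 ⇑(ofLevelOne (Gamma0 1) E₄cube)) = 1 := constantCoeff_qExpansion_E₄cube
  have h2 : PowerSeries.constantCoeff (qExpansion 1 ⇑(ofLevelOne (Gamma0 1) delta)) = 0 := constantCoeff_qExpansion_delta
  rw [h1, h2, mul_zero] at hcoef
  exact one_ne_zero hcoef

end Summit.BirchSwinnertonDyer.BirchSwinnertonDyer.Theorems.ManinLocalTwoThree.WitnessInvariance

end
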